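import Summits.CriticalPhenomena.CardyFormulaZ2.Theorems.CardyUniqueLimitCardyRigidityFarFieldBase
import HarnessLib

/-!
# A kernel with the far-field identities is affine-beta (deterministic half of STUB C)

Sub-problem `CriticalPhenomena/CardyFormulaZ2`; crux
`Summit.CriticalPhenomena.CardyFormulaZ2.Theses.CardyUniqueLimit.CardyRigidity`
(stmt-CriticalPhenomena-0746), line `crossing_martingale` (skeleton `Lines/crossing_martingale.lean`,
definitions module `Theorems/CardyUniqueLimitCardyRigidityDefs.lean`), STUB C `stub_kernelAffineBeta`
("a crossing-martingale kernel is affine-beta", general continuous `f`).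

Main theorem `affineBeta_of_farField` (registered glue sub-goal; proof
`AffineBeta.affineBeta_of_farFieldIdentities`): if `f` is continuous on `(0,1)` and
`HasFarFieldIdentities f κ` for some real `κ`, then `f = A·I_{2/3} + B` on `(0,1)`.
Steps: `κ = 0` ⇒ `f` constant (`AffineBeta.const_of_kappa_zero`); `κ ≠ 0` ⇒ `f ∈ C²(0,1)`
(`AffineBeta.differentiable_of_kappa_ne_zero`, through the standard base and the inverse Möbius
shift) and the generator equation at every configuration (`AffineBeta.ode_at_base`); the bases
`(2η/(1+η),1,2)` and `(4η/(η+3),1,4)` of the modulus `η` eliminate to `(6-κ)f'(η) = 0` and Cardy's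
equation at `κ = 6` (`AffineBeta.algebra_step`); finally `f' ≡ 0` or `κ = 6`, and Cardy's equation
integrates to `f = A·F + B = A·I_{2/3} + B` (`AffineBeta.affine_cardy_of_ode`, `betaLaw_two_thirds`,
`cardyFunction_eq_incBeta13_div_holds`).

With C1 (see `…FarFieldBase`) this proves `stub_kernelAffineBeta` (with `a = 2/3`), and also
`stub_betaPinning` (`I_a = A·I_{2/3} + B` on `(0,1)` forces `a = 2/3`).

References: Cardy (1992), eq. (8); Lawler–Schramm–Werner (2001), §3; Werner (2007), §3.
-/

noncomputable section

open MeasureTheory Filter Set Topology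
open scoped NNReal
open Literature.Probability.RandomPlanarGeometry

namespace Summit.CriticalPhenomena.CardyFormulaZ2.Cruxes.CardyRigidity.CrossingMartingale

namespace AffineBeta

/-! ### `κ = 0`: the kernel is constant -/

/-- If the far-field identities hold with `κ = 0`, the kernel is constant on `(0,1)`. [folklore] -/
theorem const_of_kappa_zero {f : ℝ → ℝ} (hf : ContinuousOn f (Ioo 0 1))
    (h : HasFarFieldIdentities f 0) : ∃ C : ℝ, EqOn f (fun _ ↦ C) (Ioo 0 1) := by
  -- `f u = f η` for `0 < u < (1+3η)/4`
  have claim : ∀ η ∈ Ioo (0 : ℝ) 1, ∀ u ∈ Ioo (0 : ℝ) ((1 + 3 * η) / 4), f u = f η := by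
    intro η hη u hu
    obtain ⟨a, A, ha0, ha1, -, -, -, -, hG0, hT0, hT⟩ := standardBase hη
    obtain ⟨C, hC⟩ := (family_bootstrap hf h ha0 ha1 (by norm_num : (1 : ℝ) < 2)).1 rfl
    obtain ⟨hTmem, hGT, -⟩ := hT u hu
    have h1 := hC hTmem
    have h0 := hC (x := 0) ⟨by linarith, by norm_num⟩
    simp only at h1 h0
    rw [hGT] at h1
    rw [hG0] at h0
    rw [h1, h0]
  refine ⟨f (1 / 2), fun η hη ↦ ?_⟩
  rcases le_or_gt η (1 / 2) with hle | hlt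
  · exact claim (1 / 2) ⟨by norm_num, by norm_num⟩ η ⟨hη.1, by linarith⟩
  · exact (claim η hη (1 / 2) ⟨by norm_num, by linarith [hη.2]⟩).symm

/-! ### `κ ≠ 0`: the kernel is `C²` -/

/-- If the far-field identities hold with `κ ≠ 0`, the kernel is twice differentiable on `(0,1)`.
[folklore] -/
theorem differentiable_of_kappa_ne_zero {f : ℝ → ℝ} (hf : ContinuousOn f (Ioo 0 1)) {κ : ℝ}
    (hκ : κ ≠ 0) (h : HasFarFieldIdentities f κ) :
    ∀ η ∈ Ioo (0 : ℝ) 1, DifferentiableAt ℝ f η ∧ DifferentiableAt ℝ (deriv f) η := by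
  intro η hη
  obtain ⟨a, A, ha0, ha1, hA0, hAa, hηA, hηJ, hG0, hT0, hT⟩ := standardBase hη
  obtain ⟨F', F'', hF', hF'', -⟩ :=
    (family_bootstrap hf h ha0 ha1 (by norm_num : (1 : ℝ) < 2)).2 hκ
  set T : ℝ → ℝ := fun u ↦ (A * a - u * 1) / (u - A) with hTdef
  set J : Set ℝ := Ioo 0 ((1 + 3 * η) / 4) with hJ
  have hJo : IsOpen J := isOpen_Ioo
  have hηmem : η ∈ J := ⟨hη.1, hηJ⟩
  -- `f = F ∘ T` on `J`
  have hfT : EqOn f (fun u ↦ f (cardyEta (a + T u) (1 + T u) (2 + T u))) J := by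
    intro u hu
    simp only [hTdef]
    rw [(hT u hu).2.1]
  have hderiv : ∀ u ∈ J, HasDerivAt f (F' (T u) * (A * (1 - a) / (u - A) ^ 2)) u := by
    intro u hu
    obtain ⟨hTmem, -, hTd⟩ := hT u hu
    have hc := HasDerivAt.comp u (hF' (T u) hTmem) hTd
    exact hc.congr_of_eventuallyEq (hfT.eventuallyEq_of_mem (hJo.mem_nhds hu))
  have hd1 : EqOn (deriv f) (fun u ↦ F' (T u) * (A * (1 - a) / (u - A) ^ 2)) J :=
    fun u hu ↦ (hderiv u hu).deriv
  refine ⟨(hderiv η hηmem).differentiableAt, ?_⟩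
  have hTη : T η ∈ Ioo (-a) 1 := (hT η hηmem).1
  have hηA' : η - A ≠ 0 := by linarith
  have hrhs : DifferentiableAt ℝ (fun u ↦ F' (T u) * (A * (1 - a) / (u - A) ^ 2)) η := by
    refine DifferentiableAt.mul ?_ ?_
    · have hc := HasDerivAt.comp η (hF'' (T η) hTη) (hT η hηmem).2.2
      exact hc.differentiableAt
    · exact (differentiableAt_const _).div ((differentiableAt_id.sub_const A).pow 2)
        (pow_ne_zero 2 hηA')
  exact hrhs.congr_of_eventuallyEq (hd1.eventuallyEq_of_mem (hJo.mem_nhds hηmem))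

/-- **The generator equation at one configuration.** For `κ ≠ 0` and marks `0 < a < b < c` of
modulus `η = cardyEta a b c`:
`κ (f''(η) c₁² + f'(η) c₁') + 4(a⁻¹ + b⁻¹ + c⁻¹) f'(η) c₁ = 0`, with `c₁, c₁'` the first two
`θ`-derivatives of the translated modulus at `θ = 0`. [cite: LawlerSchrammWerner2001, §3] -/
theorem ode_at_base {f : ℝ → ℝ} (hf : ContinuousOn f (Ioo 0 1)) {κ : ℝ} (hκ : κ ≠ 0)
    (h : HasFarFieldIdentities f κ) {a b c : ℝ} (ha : 0 < a) (hab : a < b) (hbc : b < c) :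
    κ * (deriv (deriv f) (cardyEta a b c) * ((c - b) * (b - a) / ((c - a) * b ^ 2)) ^ 2 +
        deriv f (cardyEta a b c) * (-2 * ((c - b) * (b - a)) / ((c - a) * b ^ 3))) +
      4 * (a⁻¹ + b⁻¹ + c⁻¹) * (deriv f (cardyEta a b c) * ((c - b) * (b - a) / ((c - a) * b ^ 2)))
      = 0 := by
  have hd := differentiable_of_kappa_ne_zero hf hκ h
  obtain ⟨F', F'', hF', hF'', hode⟩ := (family_bootstrap hf h ha hab hbc).2 hκ
  have hca : c - a ≠ 0 := by linarith
  have hI0 : (0 : ℝ) ∈ Ioo (-a) 1 := ⟨by linarith, by norm_num⟩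
  -- forward chain rule: `F' θ = f'(η(θ)) c₁(θ)` on `(-a, 1)`
  have hmem : ∀ θ ∈ Ioo (-a) 1, cardyEta (a + θ) (b + θ) (c + θ) ∈ Ioo (0 : ℝ) 1 := by
    intro θ hθ
    simp only [mem_Ioo] at hθ
    exact cardyEta_mem_Ioo (by linarith) (by linarith) (by linarith)
  have hF'eq : EqOn F' (fun θ ↦ deriv f (cardyEta (a + θ) (b + θ) (c + θ)) *
      ((c - b) * (b - a) / ((c - a) * (b + θ) ^ 2))) (Ioo (-a) 1) := by
    intro θ hθ
    have hbθ : b + θ ≠ 0 := by simp only [mem_Ioo] at hθ; linarith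
    have hc : HasDerivAt (fun θ ↦ f (cardyEta (a + θ) (b + θ) (c + θ)))
        (deriv f (cardyEta (a + θ) (b + θ) (c + θ)) *
          ((c - b) * (b - a) / ((c - a) * (b + θ) ^ 2))) θ :=
      HasDerivAt.comp θ ((hd _ (hmem θ hθ)).1.hasDerivAt) (hasDerivAt_cardyEta_shift hca hbθ)
    exact (hF' θ hθ).unique hc
  -- differentiate once more at `θ = 0`
  have hb0 : b + 0 ≠ 0 := by linarith
  have hc2 := (HasDerivAt.comp (0 : ℝ) ((hd _ (hmem 0 hI0)).2.hasDerivAt)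
      (hasDerivAt_cardyEta_shift hca hb0)).mul (hasDerivAt_cardyEta_shift_deriv (c := c) hca hb0)
  have hF''0 := (hF'' 0 hI0).unique
    (hc2.congr_of_eventuallyEq (hF'eq.eventuallyEq_of_mem (isOpen_Ioo.mem_nhds hI0)))
  have h0 := hode 0 hI0
  rw [hF''0, hF'eq hI0] at h0
  simp only [add_zero, Function.comp] at h0
  linear_combination h0

/-! ### The two bases of a modulus and the elimination `κ = 6` or `f' = 0` -/

/-- Base `q = 1/2`: marks `(2η/(1+η), 1, 2)` have modulus `η`; values of `c₁(0)`, `c₁'(0)` and the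
weight `4 Σ ξᵢ⁻¹`. [folklore] -/
theorem base_half_values {η : ℝ} (hη : η ∈ Ioo (0 : ℝ) 1) :
    0 < 2 * η / (1 + η) ∧ 2 * η / (1 + η) < 1 ∧ cardyEta (2 * η / (1 + η)) 1 2 = η ∧
    (2 - 1) * (1 - 2 * η / (1 + η)) / ((2 - 2 * η / (1 + η)) * 1 ^ 2) = (1 - η) / 2 ∧
    -2 * ((2 - 1) * (1 - 2 * η / (1 + η))) / ((2 - 2 * η / (1 + η)) * 1 ^ 3) = -(1 - η) ∧
    4 * ((2 * η / (1 + η))⁻¹ + 1⁻¹ + 2⁻¹) = (2 + 8 * η) / η := by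
  obtain ⟨hη0, hη1⟩ := hη
  have h1η : (1 + η) ≠ 0 := by linarith
  have hη0' : η ≠ 0 := hη0.ne'
  have h2 : (2 : ℝ) - 2 * η / (1 + η) = 2 / (1 + η) := by field_simp; ring
  have h1 : (1 : ℝ) - 2 * η / (1 + η) = (1 - η) / (1 + η) := by field_simp; ring
  refine ⟨by positivity, by rw [div_lt_one (by linarith)]; linarith, ?_, ?_, ?_, ?_⟩
  · rw [cardyEta_apply, h2]; field_simp; norm_num
  · rw [h2, h1]; field_simp; norm_num
  · rw [h2, h1]; field_simp; norm_num
  · field_simp; ring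

/-- Base `q = 1/4`: marks `(4η/(η+3), 1, 4)` have modulus `η`; values of `c₁(0)`, `c₁'(0)` and
the weight. [folklore] -/
theorem base_quarter_values {η : ℝ} (hη : η ∈ Ioo (0 : ℝ) 1) :
    0 < 4 * η / (η + 3) ∧ 4 * η / (η + 3) < 1 ∧ cardyEta (4 * η / (η + 3)) 1 4 = η ∧
    (4 - 1) * (1 - 4 * η / (η + 3)) / ((4 - 4 * η / (η + 3)) * 1 ^ 2) = 3 * (1 - η) / 4 ∧
    -2 * ((4 - 1) * (1 - 4 * η / (η + 3))) / ((4 - 4 * η / (η + 3)) * 1 ^ 3)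
      = -(3 * (1 - η) / 2) ∧
    4 * ((4 * η / (η + 3))⁻¹ + 1⁻¹ + 4⁻¹) = (3 + 6 * η) / η := by
  obtain ⟨hη0, hη1⟩ := hη
  have h3η : (η + 3) ≠ 0 := by linarith
  have hη0' : η ≠ 0 := hη0.ne'
  have h4 : (4 : ℝ) - 4 * η / (η + 3) = 12 / (η + 3) := by field_simp; ring
  have h1 : (1 : ℝ) - 4 * η / (η + 3) = 3 * (1 - η) / (η + 3) := by field_simp; ring
  refine ⟨by positivity, by rw [div_lt_one (by linarith)]; linarith, ?_, ?_, ?_, ?_⟩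
  · rw [cardyEta_apply, h4]; field_simp; norm_num
  · rw [h4, h1]; field_simp; norm_num
  · rw [h4, h1]; field_simp; norm_num
  · field_simp; ring

/-- **Elimination.** The generator equations at the two bases of `η` force `(6 - κ) f'(η) = 0`,
and at `κ = 6` Cardy's equation `3η(1-η) f'' + 2(1-2η) f' = 0`. [cite: Cardy1992, eq. (8)] -/
theorem algebra_step {η κ f₁ f₂ : ℝ} (hη : η ∈ Ioo (0 : ℝ) 1)
    (h₁ : κ * (f₂ * ((1 - η) / 2) ^ 2 + f₁ * (-(1 - η))) +
      (2 + 8 * η) / η * (f₁ * ((1 - η) / 2)) = 0)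
    (h₂ : κ * (f₂ * (3 * (1 - η) / 4) ^ 2 + f₁ * (-(3 * (1 - η) / 2))) +
      (3 + 6 * η) / η * (f₁ * (3 * (1 - η) / 4)) = 0) :
    (6 - κ) * f₁ = 0 ∧ (κ = 6 → 3 * η * (1 - η) * f₂ + 2 * (1 - 2 * η) * f₁ = 0) := by
  obtain ⟨hη0, hη1⟩ := hη
  have hη0' : η ≠ 0 := hη0.ne'
  have hη1' : 1 - η ≠ 0 := by linarith
  -- normalised forms `P₁ = 0`, `P₂ = 0`
  have hP₁ : κ * η * (1 - η) * f₂ + (4 + 16 * η - 4 * κ * η) * f₁ = 0 := by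
    have key : κ * (f₂ * ((1 - η) / 2) ^ 2 + f₁ * (-(1 - η))) +
        (2 + 8 * η) / η * (f₁ * ((1 - η) / 2)) =
        (1 - η) / (4 * η) * (κ * η * (1 - η) * f₂ + (4 + 16 * η - 4 * κ * η) * f₁) := by
      field_simp; ring
    rw [key] at h₁
    rcases mul_eq_zero.1 h₁ with h | h
    · exact absurd h (div_ne_zero hη1' (by positivity))
    · exact h
  have hP₂ : 3 * κ * η * (1 - η) * f₂ + (12 + 24 * η - 8 * κ * η) * f₁ = 0 := by
    have key : κ * (f₂ * (3 * (1 - η) / 4) ^ 2 + f₁ * (-(3 * (1 - η) / 2))) +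
        (3 + 6 * η) / η * (f₁ * (3 * (1 - η) / 4)) =
        3 * (1 - η) / (16 * η) *
          (3 * κ * η * (1 - η) * f₂ + (12 + 24 * η - 8 * κ * η) * f₁) := by
      field_simp; ring
    rw [key] at h₂
    rcases mul_eq_zero.1 h₂ with h | h
    · exact absurd h (div_ne_zero (by positivity) (by positivity))
    · exact h
  constructor
  · have h4 : 4 * η * ((6 - κ) * f₁) = 0 := by linear_combination 3 * hP₁ - hP₂
    rcases mul_eq_zero.1 h4 with h | h
    · exact absurd h (by positivity)
    · exact h
  · intro hκ
    subst hκ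
    linear_combination (1 / 2 : ℝ) * hP₁

/-! ### Main theorem of the file -/

/-- **A kernel with the far-field identities is affine-beta.** If `f` is continuous on `(0,1)` and
satisfies the far-field second-moment identities with some `κ`, then `f = A·I_{2/3} + B` on
`(0,1)` (with `A = 0` unless `κ = 6`). This is the deterministic half ("regularity bootstrap +
Cardy's equation") of STUB C of the line `crossing_martingale`.
[cite: Cardy1992, eq. (8)] [cite: LawlerSchrammWerner2001, §3] -/
theorem affineBeta_of_farFieldIdentities {f : ℝ → ℝ} (hf : ContinuousOn f (Ioo 0 1)) {κ : ℝ}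
    (h : HasFarFieldIdentities f κ) :
    ∃ A B : ℝ, EqOn f (fun η ↦ A * betaLaw (2 / 3) η + B) (Ioo 0 1) := by
  by_cases hκ : κ = 0
  · subst hκ
    obtain ⟨C, hC⟩ := const_of_kappa_zero hf h
    exact ⟨0, C, fun η hη ↦ by simp [hC hη]⟩
  have hd := differentiable_of_kappa_ne_zero hf hκ h
  -- the elimination at every modulus
  have helim : ∀ η ∈ Ioo (0 : ℝ) 1, (6 - κ) * deriv f η = 0 ∧
      (κ = 6 → 3 * η * (1 - η) * deriv (deriv f) η + 2 * (1 - 2 * η) * deriv f η = 0) := by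
    intro η hη
    obtain ⟨ha0, ha1, hGa, hc₁, hc₁', hw⟩ := base_half_values hη
    obtain ⟨hb0, hb1, hGb, hd₁, hd₁', hw'⟩ := base_quarter_values hη
    have h₁ := ode_at_base hf hκ h ha0 ha1 (by norm_num : (1 : ℝ) < 2)
    have h₂ := ode_at_base hf hκ h hb0 hb1 (by norm_num : (1 : ℝ) < 4)
    rw [hGa, hc₁, hc₁', hw] at h₁
    rw [hGb, hd₁, hd₁', hw'] at h₂
    exact algebra_step hη h₁ h₂
  by_cases hall : ∀ η ∈ Ioo (0 : ℝ) 1, deriv f η = 0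
  · -- `f' ≡ 0`: constant kernel
    have one_half : (1 / 2 : ℝ) ∈ Ioo (0 : ℝ) 1 := ⟨by norm_num, by norm_num⟩
    refine ⟨0, f (1 / 2), fun η hη ↦ ?_⟩
    simp only [zero_mul, zero_add]
    exact isOpen_Ioo.is_const_of_deriv_eq_zero isPreconnected_Ioo
      (fun x hx ↦ (hd x hx).1.differentiableWithinAt) (fun x hx ↦ hall x hx) hη one_half
  · -- some `f'(η₀) ≠ 0`: `κ = 6`, Cardy's equation everywhere, affine-Cardy
    push Not at hall
    obtain ⟨η₀, hη₀, hne⟩ := hall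
    have hκ6 : κ = 6 := by
      have := (helim η₀ hη₀).1
      rcases mul_eq_zero.1 this with h6 | h6
      · linarith
      · exact absurd h6 hne
    obtain ⟨A, B, hAB⟩ := affine_cardy_of_ode (f₁ := deriv f) (f₂ := deriv (deriv f))
      (fun η hη ↦ (hd η hη).1.hasDerivAt) (fun η hη ↦ (hd η hη).2.hasDerivAt)
      (fun η hη ↦ (helim η hη).2 hκ6)
    refine ⟨A, B, fun η hη ↦ ?_⟩
    rw [hAB hη]
    simp only [cardyFunction_eq_betaLaw hη]

end AffineBeta

/-- **A kernel with the far-field identities is affine-beta** (registered glue sub-goal of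
stmt-CriticalPhenomena-0746; the deterministic half of STUB C `stub_kernelAffineBeta`): if `f` is
continuous on `(0,1)` and satisfies the far-field second-moment identities with some `κ`, then
`f = A·I_{2/3} + B` on `(0,1)`. [cite: Cardy1992, eq. (8)] [cite: LawlerSchrammWerner2001, §3] -/
theorem affineBeta_of_farField : ∀ f : ℝ → ℝ, ContinuousOn f (Ioo 0 1) → ∀ κ : ℝ, HasFarFieldIdentities f κ → ∃ A B : ℝ, EqOn f (fun η ↦ A * betaLaw (2 / 3) η + B) (Ioo 0 1) :=
  fun _ hf _ h ↦ AffineBeta.affineBeta_of_farFieldIdentities hf h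

end Summit.CriticalPhenomena.CardyFormulaZ2.Cruxes.CardyRigidity.CrossingMartingale

end
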